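import Literature.MathematicalPhysics.QuantumLattice.SpinSectorPartitionFnBandwidthTransfer
import HarnessLib

/-!
# The thermal pressure of the 2D `t–t'` Hubbard model in a general spin sector `(n↑, n↓)`:
# existence of the thermodynamic limit and the spin-resolved density legs

Topic `MathematicalPhysics/QuantumLattice` (family `hubbard`). `HubbardTTPrimeThermalPressureLimit.lean` built the
canonical free entropy per site `p(β; t,t',U; n) = pressureTT' β t t' U n` of the `S^z = 0` sector
`(N↑, N↓) = (⌊nL²/2⌋, ⌊nL²/2⌋)` of the `L × L` torus. The grand-canonical trace, a Zeeman field, and the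
equivalence of ensembles all need the GENERAL spin sectors: with `k_L(x) := ⌊xL²⌋ = halfRectN (2x) L` for a
spin density `x ∈ [0, 1)`,

`p_L(β; t,t',U; x, y) := L⁻² log Re Z_β(H^{torus}_{L×L}; k_L(x), k_L(y))`  (`spinSectorPressureTT'`).

* §1 finite-volume tools for general sectors: the crude floor `e^{−βU⁺(q+q')} ≤ Z(a×b; q, q')`, the complement
  filling `e^{−β((8|t|+16|t'|)(2ℓ+r) + U⁺(q+q'))} Z(ℓ×ℓ; p,p') ≤ Z((ℓ+r)²; p+q, p'+q')`
  (`partitionFn_hubbardRectTorusTT'_square_fill₂`), and the VOLUME-FREE one-electron prices of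
  `SpinSectorPartitionFnBandwidthTransfer` telescoped against the binomial entropy in ONE species
  (`log_partitionFn_sub_log_choose_up_steps_mem_local`, `…_down_steps_…`:
  `−βκ₊ d ≤ [log Z(k+d,l) − log C(|Λ|,k+d)] − [log Z(k,l) − log C(|Λ|,k)] ≤ βκ₋ d`);
* §2 the three inputs of Fekete's lemma along squares (`SquareTilingLimit.tendsto_of_tiling_of_filling`) for
  `b_L := −p_L(x,y)` (`β ≥ 0`, `U ≥ 0`, `x, y ∈ [0,1)`): (i) the a-priori ceiling
  `p_M(x,y) ≤ log 4 + β(8|t|+8|t'|) + log 2 + β(4|t|+4|t'|+U)` (transfer to the diagonal sector `(k_M(y), k_M(y))`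
  at the price of the binomial entropy `≤ M² log 2` and the band `βκ`, then `sectorPressureTT'_le_apriori`);
  (ii) TILING `p_M ≤ p_{(k+1)M} + (β(16|t|+32|t'|) + 4)/M + 2β(4|t|+4|t'|+U)/M²` — the `≤ (k+1)²` rounding electrons
  of EACH species cost `2 log M + βκ₊` each, by the volume-free transfer (no holes factor); (iii) FILLING with
  `C = β(16|t|+32|t'|) + 2βU + 4`;
* §3 **`tendsto_spinSectorPressureTT'`**: `p_L(x,y) → pressureTT'₂ β t t' U x y` (a real number, `limUnder`);
  the diagonal is the canonical number of record, `pressureTT'₂ β t t' U (n/2) (n/2) = pressureTT' β t t' U n`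
  (`pressureTT'₂_half_half`);
* §4 **spin-resolved density legs**: `x ↦ p(x, y) − H_b(x)` and `y ↦ p(x, y) − H_b(y)` are Lipschitz with the
  one-sided constants `βκ₊ = β(4|t|+4|t'|+U)` (downwards) / `βκ₋ = β(4|t|+4|t'|)` (upwards)
  (`pressureTT'₂_sub_binEntropy_sub_mem_fst/_snd`) — the spin-resolved chemical potentials `βμ_σ = −∂p/∂n_σ`
  lie in the band `log(n_σ/(1−n_σ)) + β[−(4|t|+4|t'|), 4|t|+4|t'|+U]`.

Everything is PROVED; one real definition (`pressureTT'₂`, a `limUnder` with its `tendsto` next to it) and one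
finite-volume abbreviation (`spinSectorPressureTT'`), no named fact.

## Mathlib / tree search

REUSED: `tendsto_of_tiling_of_filling` (`SquareTilingLimit`), `prod_partitionFn_hubbardRectTorusTT'_squares_le`,
`partitionFn_hubbardRectTorusTT'_cut`, `partitionFn_spinSector_hubbardRectTorusTT'_swap` (`HubbardTTPrimeTorusPartitionFnTiling`),
`exp_neg_le_partitionFn_spinSector_twoGraph` (`TorusSectorPressureTypeBoundAllTori`), `sq_mul_halfRectN_le`, `halfRectN_lt_sq`,
`halfRectN_sub_le_complement`, `tiling_div_step`, `sectorPressureTT'_le_apriori`, `tendsto_sectorPressureTT'`, `pressureTT'_zero`,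
`log_partitionFn_sectorHamiltonianTT'_eq_rect` (`HubbardTTPrimeThermalPressureLimit`),
`log_partitionFn_spinSector_hubbardRectTorusTT'_succ_up_mem_local/_succ_down_mem_local` (`SpinSectorPartitionFnBandwidthTransfer`),
Mathlib `Nat.choose_succ_right_eq`, `Nat.choose_le_two_pow`, `tendsto_nhds_limUnder`, `le_of_tendsto_of_tendsto`.
`lean search 'spinSectorPressure|pressureTT.₂'`: nothing (2026-08-27).

## References

* D. Ruelle, *Statistical Mechanics: Rigorous Results* (1969), §2.2, §3.3–3.4. [cite: Ruelle1969, §3.4]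
* R. B. Israel, *Convexity in the Theory of Lattice Gases* (1979), Thm. I.2.3–I.2.4. [cite: Israel1979, Thm. I.2.4]
-/

noncomputable section

namespace Literature.MathematicalPhysics.QuantumLattice

open Matrix Finset HubbardWave0 Literature.Probability.LatticeModels LiebThm1
open _root_.Filter
open scoped _root_.Topology ComplexOrder BigOperators

namespace ThermodynamicLimit

/-! ### §1 Finite-volume tools for general spin sectors -/

section Tools

/-- **Crude floor for a rectangular torus, general sector**: `e^{−βU⁺(q+q')} ≤ Z(a×b; q, q')` for `q, q' ≤ ab`
(one occupation-basis vector has at most `min(q,q') ≤ q + q'` doubly occupied sites). [cite: Ruelle1969, §3.3] -/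
theorem exp_neg_le_partitionFn_spinSector_hubbardRectTorusTT'₂ (a b : ℕ) (t t' U : ℝ) {β : ℝ} (hβ : 0 ≤ β)
    {q q' : ℕ} (hq : q ≤ a * b) (hq' : q' ≤ a * b) :
    Real.exp (-(β * max U 0 * (q + q'))) ≤
      (partitionFn β (spinSectorHamiltonian q q' (hubbardRectTorusTT' a b t t' U))).re := by
  have hqc : q ≤ Fintype.card (Fin a ×ₗ Fin b) := by rw [card_rectSites]; exact hq
  have hqc' : q' ≤ Fintype.card (Fin a ×ₗ Fin b) := by rw [card_rectSites]; exact hq'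
  have h := exp_neg_le_partitionFn_spinSector_twoGraph (fermionRectTorusGraph a b) (fermionRectTorusDiagGraph a b)
    t U t' 0 hβ hqc hqc'
  rw [add_zero] at h
  unfold hubbardRectTorusTT'
  refine le_trans (Real.exp_le_exp.2 (neg_le_neg ?_)) h
  have hmin : ((min q q' : ℕ) : ℝ) ≤ (q : ℝ) + q' := by
    have : min q q' ≤ q + q' := (min_le_left q q').trans (Nat.le_add_right q q')
    exact_mod_cast this
  exact mul_le_mul_of_nonneg_left hmin (mul_nonneg hβ (le_max_right U 0))

/-- **Monotonicity up to the complement, general sector.** The big `t–t'` torus `(ℓ+r) × (ℓ+r)` contains the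
corner torus `ℓ × ℓ` in the sector `(p, p')` plus `q ≤ rℓ + r(ℓ+r)` up and `q' ≤ rℓ + r(ℓ+r)` down electrons parked
in the two complementary rectangular tori at the crude cost:
`e^{−β((8|t|+16|t'|)(2ℓ+r) + U⁺(q+q'))} · Z(ℓ×ℓ; p,p') ≤ Z((ℓ+r)×(ℓ+r); p+q, p'+q')`. [cite: Ruelle1969, §3.3] -/
theorem partitionFn_hubbardRectTorusTT'_square_fill₂ (ℓ r : ℕ) (t t' U : ℝ) {β : ℝ} (hβ : 0 ≤ β) (p p' : ℕ)
    {q q' : ℕ} (hq : q ≤ r * ℓ + r * (ℓ + r)) (hq' : q' ≤ r * ℓ + r * (ℓ + r)) :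
    Real.exp (-(β * ((8 * |t| + 16 * |t'|) * (2 * ℓ + r) + max U 0 * (q + q')))) *
        (partitionFn β (spinSectorHamiltonian p p' (hubbardRectTorusTT' ℓ ℓ t t' U))).re ≤
      (partitionFn β (spinSectorHamiltonian (p + q) (p' + q')
        (hubbardRectTorusTT' (ℓ + r) (ℓ + r) t t' U))).re := by
  -- split the extra electrons of each species between the two rectangles
  set q₁ : ℕ := min q (r * ℓ) with hq₁
  set q₂ : ℕ := q - q₁ with hq₂
  set q₁' : ℕ := min q' (r * ℓ) with hq₁'
  set q₂' : ℕ := q' - q₁' with hq₂'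
  have hq₁le : q₁ ≤ r * ℓ := min_le_right _ _
  have hqsplit : q = q₁ + q₂ := by have := min_le_left q (r * ℓ); omega
  have hq₂le : q₂ ≤ r * (ℓ + r) := by
    rcases le_total q (r * ℓ) with h | h
    · have : q₁ = q := min_eq_left h
      omega
    · have : q₁ = r * ℓ := min_eq_right h
      omega
  have hq₁le' : q₁' ≤ r * ℓ := min_le_right _ _
  have hqsplit' : q' = q₁' + q₂' := by have := min_le_left q' (r * ℓ); omega
  have hq₂le' : q₂' ≤ r * (ℓ + r) := by
    rcases le_total q' (r * ℓ) with h | h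
    · have : q₁' = q' := min_eq_left h
      omega
    · have : q₁' = r * ℓ := min_eq_right h
      omega
  -- big cut along the major direction: blocks `ℓ × (ℓ+r)` and `r × (ℓ+r)`
  have hcut1 := partitionFn_hubbardRectTorusTT'_cut ℓ r (ℓ + r) t t' U hβ (p + q₁) (p' + q₁') q₂ q₂'
  -- the first block: swap, and cut again into `ℓ × ℓ` and `r × ℓ`
  have hswap := congrArg Complex.re
    (partitionFn_spinSector_hubbardRectTorusTT'_swap (ℓ + r) ℓ t t' U β (p + q₁) (p' + q₁'))
  have hcut2 := partitionFn_hubbardRectTorusTT'_cut ℓ r ℓ t t' U hβ p p' q₁ q₁'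
  -- crude floors on the two rectangles
  have hB1 := exp_neg_le_partitionFn_spinSector_hubbardRectTorusTT'₂ r ℓ t t' U hβ hq₁le hq₁le'
  have hB2 := exp_neg_le_partitionFn_spinSector_hubbardRectTorusTT'₂ r (ℓ + r) t t' U hβ hq₂le hq₂le'
  have hZsq0 := partitionFn_spinSector_hubbardRectTorusTT'_re_nonneg ℓ ℓ t t' U β p p'
  have hZmid0 := partitionFn_spinSector_hubbardRectTorusTT'_re_nonneg ℓ (ℓ + r) t t' U β (p + q₁) (p' + q₁')
  have e0 : 0 ≤ Real.exp (-(β * ((8 * |t| + 16 * |t'|) * ((ℓ + r : ℕ) : ℝ)))) := (Real.exp_pos _).le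
  have e1 : 0 ≤ Real.exp (-(β * ((8 * |t| + 16 * |t'|) * (ℓ : ℝ)))) := (Real.exp_pos _).le
  -- step 1: the corner torus and the small rectangle inside the first block
  have hstep1 : Real.exp (-(β * ((8 * |t| + 16 * |t'|) * (ℓ : ℝ)))) *
      (partitionFn β (spinSectorHamiltonian p p' (hubbardRectTorusTT' ℓ ℓ t t' U))).re *
      Real.exp (-(β * max U 0 * (q₁ + q₁'))) ≤
      (partitionFn β (spinSectorHamiltonian (p + q₁) (p' + q₁') (hubbardRectTorusTT' ℓ (ℓ + r) t t' U))).re := by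
    rw [hswap]
    exact le_trans (mul_le_mul_of_nonneg_left hB1 (mul_nonneg e1 hZsq0)) hcut2
  -- step 2: the first block and the big rectangle inside the big torus
  have hstep2 : Real.exp (-(β * ((8 * |t| + 16 * |t'|) * ((ℓ + r : ℕ) : ℝ)))) *
      (Real.exp (-(β * ((8 * |t| + 16 * |t'|) * (ℓ : ℝ)))) *
        (partitionFn β (spinSectorHamiltonian p p' (hubbardRectTorusTT' ℓ ℓ t t' U))).re *
        Real.exp (-(β * max U 0 * (q₁ + q₁')))) *
      Real.exp (-(β * max U 0 * (q₂ + q₂'))) ≤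
      (partitionFn β (spinSectorHamiltonian (p + q₁ + q₂) (p' + q₁' + q₂')
        (hubbardRectTorusTT' (ℓ + r) (ℓ + r) t t' U))).re := by
    refine le_trans ?_ hcut1
    exact mul_le_mul (mul_le_mul_of_nonneg_left hstep1 e0) hB2 (Real.exp_pos _).le (mul_nonneg e0 hZmid0)
  -- the total exponential splits into the four factors
  have hexp : Real.exp (-(β * ((8 * |t| + 16 * |t'|) * (2 * ℓ + r) + max U 0 * (q + q')))) =
      Real.exp (-(β * ((8 * |t| + 16 * |t'|) * ((ℓ + r : ℕ) : ℝ)))) *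
        Real.exp (-(β * ((8 * |t| + 16 * |t'|) * (ℓ : ℝ)))) *
        Real.exp (-(β * max U 0 * (q₁ + q₁'))) * Real.exp (-(β * max U 0 * (q₂ + q₂'))) := by
    rw [← Real.exp_add, ← Real.exp_add, ← Real.exp_add]
    congr 1
    rw [hqsplit, hqsplit']
    push_cast
    ring
  rw [hexp, show p + q = p + q₁ + q₂ by omega, show p' + q' = p' + q₁' + q₂' by omega]
  calc _ = Real.exp (-(β * ((8 * |t| + 16 * |t'|) * ((ℓ + r : ℕ) : ℝ)))) *
        (Real.exp (-(β * ((8 * |t| + 16 * |t'|) * (ℓ : ℝ)))) *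
          (partitionFn β (spinSectorHamiltonian p p' (hubbardRectTorusTT' ℓ ℓ t t' U))).re *
          Real.exp (-(β * max U 0 * (q₁ + q₁')))) *
        Real.exp (-(β * max U 0 * (q₂ + q₂'))) := by ring
    _ ≤ _ := hstep2

/-- `log C(M, k+1) − log C(M, k) = log((M − k)/(k + 1))` for `k + 1 ≤ M`. [folklore] -/
private theorem log_choose_succ_sub_log_choose' {M k : ℕ} (hk : k + 1 ≤ M) :
    Real.log (M.choose (k + 1)) - Real.log (M.choose k) = Real.log ((((M : ℝ) - k)) / ((k : ℝ) + 1)) := by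
  have hkM : k ≤ M := by omega
  have h := Nat.choose_succ_right_eq M k
  have hR : ((M.choose (k + 1) : ℕ) : ℝ) * ((k : ℝ) + 1) = ((M.choose k : ℕ) : ℝ) * ((M : ℝ) - k) := by
    rw [← Nat.cast_sub hkM]
    exact_mod_cast h
  have hc1 : (0 : ℝ) < ((M.choose (k + 1) : ℕ) : ℝ) := by exact_mod_cast Nat.choose_pos hk
  have hc0 : (0 : ℝ) < ((M.choose k : ℕ) : ℝ) := by exact_mod_cast Nat.choose_pos hkM
  have hk1 : (0 : ℝ) < (k : ℝ) + 1 := by positivity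
  have hMk : (0 : ℝ) < (M : ℝ) - k := by
    have : ((k : ℝ) + 1) ≤ (M : ℝ) := by exact_mod_cast hk
    linarith
  have hlog := congrArg Real.log hR
  rw [Real.log_mul hc1.ne' hk1.ne', Real.log_mul hc0.ne' hMk.ne'] at hlog
  rw [Real.log_div hMk.ne' hk1.ne']
  linarith

/-- **`d` up electrons against the binomial entropy** (`β ≥ 0`, `k + d ≤ L₁L₂ =: M`, `l ≤ M`):
`−βκ₊ d ≤ [log Z(k+d,l) − log C(M,k+d)] − [log Z(k,l) − log C(M,k)] ≤ βκ₋ d`, `κ₊ = 4|t|+4|t'|+U⁺`,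
`κ₋ = 4|t|+4|t'|+U⁻`. [cite: Ruelle1969, §3.4] -/
theorem log_partitionFn_sub_log_choose_up_steps_mem_local (L₁ L₂ : ℕ) (t t' U : ℝ) {β : ℝ} (hβ : 0 ≤ β)
    {l : ℕ} (hl : l ≤ L₁ * L₂) :
    ∀ (d k : ℕ), k + d ≤ L₁ * L₂ →
      -(β * (4 * |t| + 4 * |t'| + max U 0) * d) ≤
          (Real.log (partitionFn β (spinSectorHamiltonian (k + d) l (hubbardRectTorusTT' L₁ L₂ t t' U))).re -
              Real.log ((L₁ * L₂).choose (k + d))) -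
            (Real.log (partitionFn β (spinSectorHamiltonian k l (hubbardRectTorusTT' L₁ L₂ t t' U))).re -
              Real.log ((L₁ * L₂).choose k)) ∧
        (Real.log (partitionFn β (spinSectorHamiltonian (k + d) l (hubbardRectTorusTT' L₁ L₂ t t' U))).re -
              Real.log ((L₁ * L₂).choose (k + d))) -
            (Real.log (partitionFn β (spinSectorHamiltonian k l (hubbardRectTorusTT' L₁ L₂ t t' U))).re -
              Real.log ((L₁ * L₂).choose k)) ≤
          β * (4 * |t| + 4 * |t'| + max (-U) 0) * d := by
  intro d
  induction d with
  | zero =>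
      intro k _
      simp
  | succ d ih =>
      intro k hkd
      obtain ⟨i₁, i₂⟩ := ih (k + 1) (by omega)
      obtain ⟨s₁, s₂⟩ := log_partitionFn_spinSector_hubbardRectTorusTT'_succ_up_mem_local L₁ L₂ t t' U hβ
        (k := k) (l := l) (by omega) hl
      have hc := log_choose_succ_sub_log_choose' (M := L₁ * L₂) (k := k) (by omega)
      have e : k + 1 + d = k + (d + 1) := by ring
      rw [e] at i₁ i₂
      push_cast
      constructor <;> linarith

/-- **`d` down electrons against the binomial entropy** (`k ≤ M`, `l + d ≤ M`). [cite: Ruelle1969, §3.4] -/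
theorem log_partitionFn_sub_log_choose_down_steps_mem_local (L₁ L₂ : ℕ) (t t' U : ℝ) {β : ℝ} (hβ : 0 ≤ β)
    {k : ℕ} (hk : k ≤ L₁ * L₂) :
    ∀ (d l : ℕ), l + d ≤ L₁ * L₂ →
      -(β * (4 * |t| + 4 * |t'| + max U 0) * d) ≤
          (Real.log (partitionFn β (spinSectorHamiltonian k (l + d) (hubbardRectTorusTT' L₁ L₂ t t' U))).re -
              Real.log ((L₁ * L₂).choose (l + d))) -
            (Real.log (partitionFn β (spinSectorHamiltonian k l (hubbardRectTorusTT' L₁ L₂ t t' U))).re -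
              Real.log ((L₁ * L₂).choose l)) ∧
        (Real.log (partitionFn β (spinSectorHamiltonian k (l + d) (hubbardRectTorusTT' L₁ L₂ t t' U))).re -
              Real.log ((L₁ * L₂).choose (l + d))) -
            (Real.log (partitionFn β (spinSectorHamiltonian k l (hubbardRectTorusTT' L₁ L₂ t t' U))).re -
              Real.log ((L₁ * L₂).choose l)) ≤
          β * (4 * |t| + 4 * |t'| + max (-U) 0) * d := by
  intro d
  induction d with
  | zero =>
      intro l _
      simp
  | succ d ih =>
      intro l hld
      obtain ⟨i₁, i₂⟩ := ih (l + 1) (by omega)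
      obtain ⟨s₁, s₂⟩ := log_partitionFn_spinSector_hubbardRectTorusTT'_succ_down_mem_local L₁ L₂ t t' U hβ
        (k := k) (l := l) hk (by omega)
      have hc := log_choose_succ_sub_log_choose' (M := L₁ * L₂) (k := l) (by omega)
      have e : l + 1 + d = l + (d + 1) := by ring
      rw [e] at i₁ i₂
      push_cast
      constructor <;> linarith

/-- `0 ≤ log C(M, k) ≤ M log 2`. [folklore] -/
private theorem log_choose_mem (M k : ℕ) (hk : k ≤ M) :
    0 ≤ Real.log (M.choose k) ∧ Real.log (M.choose k) ≤ M * Real.log 2 := by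
  have hpos : (1 : ℝ) ≤ (M.choose k : ℕ) := by exact_mod_cast Nat.choose_pos hk
  refine ⟨Real.log_nonneg hpos, ?_⟩
  have h2 : ((M.choose k : ℕ) : ℝ) ≤ (2 : ℝ) ^ M := by exact_mod_cast Nat.choose_le_two_pow M k
  calc Real.log (M.choose k) ≤ Real.log ((2 : ℝ) ^ M) := Real.log_le_log (by linarith) h2
    _ = M * Real.log 2 := by rw [Real.log_pow]

end Tools

/-! ### §2 The spin-resolved finite-volume pressure and the three Fekete inputs -/

/-- **The spin-resolved finite-volume pressure** of the `L × L` torus at spin densities `(x, y) = (n↑, n↓)`: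
`p_L(β; t,t',U; x, y) = L⁻² log Re Z_β(hubbardRectTorusTT' L L t t' U; ⌊xL²⌋, ⌊yL²⌋)` (`⌊xL²⌋ = halfRectN (2x) L`).
[cite: Israel1979, Thm. I.2.4] -/
def spinSectorPressureTT' (β t t' U x y : ℝ) (L : ℕ) : ℝ :=
  Real.log (partitionFn β (spinSectorHamiltonian (halfRectN (2 * x) L) (halfRectN (2 * y) L)
    (hubbardRectTorusTT' L L t t' U))).re / (L : ℝ) ^ 2

/-- The diagonal is the canonical convention of record: `p_L(x = n/2, y = n/2) = sectorPressureTT' β t t' U n L`.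
[cite: Israel1979, Thm. I.2.4] -/
theorem spinSectorPressureTT'_half_half (β t t' U n : ℝ) (L : ℕ) :
    spinSectorPressureTT' β t t' U (n / 2) (n / 2) L = sectorPressureTT' β t t' U n L := by
  rw [spinSectorPressureTT', sectorPressureTT', log_partitionFn_sectorHamiltonianTT'_eq_rect,
    show 2 * (n / 2) = n by ring]

/-- The filling cost, pure arithmetic: `β((8|t|+16|t'|)(2ℓ+r) + U(q+q')) ≤ (β(16|t|+32|t'|) + 2βU + 4)((ℓ+r)² − ℓ² + (ℓ+r))`
for `q, q' ≤ (ℓ+r)² − ℓ²`. [folklore] -/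
private theorem fill_cost_arith {β t t' U ℓ r q q' : ℝ} (hβ : 0 ≤ β) (hU : 0 ≤ U) (hℓ : 0 ≤ ℓ) (hr : 0 ≤ r)
    (hq : q ≤ (ℓ + r) ^ 2 - ℓ ^ 2) (hq' : q' ≤ (ℓ + r) ^ 2 - ℓ ^ 2) :
    β * ((8 * |t| + 16 * |t'|) * (2 * ℓ + r) + U * (q + q')) ≤
      (β * (16 * |t| + 32 * |t'|) + 2 * (β * U) + 4) * ((ℓ + r) ^ 2 - ℓ ^ 2 + (ℓ + r)) := by
  set G : ℝ := (ℓ + r) ^ 2 - ℓ ^ 2 + (ℓ + r) with hGdef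
  have hG0' : 0 ≤ (ℓ + r) ^ 2 - ℓ ^ 2 := by nlinarith
  have hG0 : 0 ≤ G := by rw [hGdef]; positivity
  have h1 : 2 * ℓ + r ≤ 2 * G := by rw [hGdef]; nlinarith
  have h2 : 0 ≤ β * (8 * |t| + 16 * |t'|) := by positivity
  have h3 := mul_le_mul_of_nonneg_left h1 h2
  have h4 : q + q' ≤ 2 * G := by rw [hGdef]; linarith
  have h5 : 0 ≤ β * U := mul_nonneg hβ hU
  have h6 := mul_le_mul_of_nonneg_left h4 h5
  have h7 : 0 ≤ 4 * G := by positivity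
  nlinarith [h3, h6, h7, h5, hG0]

section Fekete

variable {β : ℝ} (hβ : 0 ≤ β) (t t' : ℝ) {U : ℝ} (hU : 0 ≤ U) {x y : ℝ} (hx0 : 0 ≤ x) (hx1 : x < 1)
  (hy0 : 0 ≤ y) (hy1 : y < 1)
include hβ hU hx0 hx1 hy0 hy1

/-- **(i) A-priori ceiling**: `p_M(x,y) ≤ log 4 + β(8|t|+8|t'|) + log 2 + β(4|t|+4|t'|+U)` — move the up electrons to
the diagonal sector `(⌊yM²⌋, ⌊yM²⌋)` at the price of the binomial entropy (`≤ M² log 2`) and of the band `βκ` per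
electron, then `sectorPressureTT'_le_apriori`. [cite: Ruelle1969, §3.3] -/
theorem spinSectorPressureTT'_le_apriori {M : ℕ} (hM : 1 ≤ M) :
    spinSectorPressureTT' β t t' U x y M ≤
      Real.log 4 + β * (8 * |t| + 8 * |t'|) + Real.log 2 + β * (4 * |t| + 4 * |t'| + U) := by
  have hM2 : (0 : ℝ) < (M : ℝ) ^ 2 := by
    have : (1 : ℝ) ≤ M := by exact_mod_cast hM
    positivity
  have hMM : ((M * M : ℕ) : ℝ) = (M : ℝ) ^ 2 := by push_cast; ring
  set a := halfRectN (2 * x) M with ha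
  set b := halfRectN (2 * y) M with hb
  have haM : a < M * M := halfRectN_lt_sq (by linarith) (by linarith) hM
  have hbM : b < M * M := halfRectN_lt_sq (by linarith) (by linarith) hM
  -- the diagonal sector `(b, b)` is the canonical sector of density `2y`
  have hdiag : Real.log (partitionFn β (spinSectorHamiltonian b b (hubbardRectTorusTT' M M t t' U))).re ≤
      (Real.log 4 + β * (8 * |t| + 8 * |t'|)) * (M : ℝ) ^ 2 := by
    have h := sectorPressureTT'_le_apriori hβ t t' hU (n := 2 * y) (by linarith) (by linarith) hM
    rw [sectorPressureTT', log_partitionFn_sectorHamiltonianTT'_eq_rect, div_le_iff₀ hM2] at h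
    exact h
  -- transfer in the up species between `a` and `b`
  have hκ : β * (4 * |t| + 4 * |t'| + max (-U) 0) ≤ β * (4 * |t| + 4 * |t'| + U) := by
    rw [max_eq_right (by linarith : -U ≤ 0)]
    exact mul_le_mul_of_nonneg_left (by linarith) hβ
  have hκ' : β * (4 * |t| + 4 * |t'| + max U 0) = β * (4 * |t| + 4 * |t'| + U) := by rw [max_eq_left hU]
  have hca := log_choose_mem (M * M) a haM.le
  have hcb := log_choose_mem (M * M) b hbM.le
  have hκ0 : 0 ≤ β * (4 * |t| + 4 * |t'| + U) := by positivity
  have htrans : Real.log (partitionFn β (spinSectorHamiltonian a b (hubbardRectTorusTT' M M t t' U))).re ≤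
      Real.log (partitionFn β (spinSectorHamiltonian b b (hubbardRectTorusTT' M M t t' U))).re +
        (M * M : ℕ) * Real.log 2 + β * (4 * |t| + 4 * |t'| + U) * (M * M : ℕ) := by
    rcases le_total b a with hba | hab
    · obtain ⟨d, hd'⟩ : ∃ d, a = b + d := ⟨a - b, by omega⟩
      obtain ⟨-, h₂⟩ := log_partitionFn_sub_log_choose_up_steps_mem_local M M t t' U hβ (l := b) hbM.le d b
        (by omega)
      rw [← hd'] at h₂
      have hd : (d : ℝ) ≤ (M * M : ℕ) := by exact_mod_cast (show d ≤ M * M by omega)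
      have h3 : β * (4 * |t| + 4 * |t'| + max (-U) 0) * d ≤ β * (4 * |t| + 4 * |t'| + U) * (M * M : ℕ) :=
        (mul_le_mul_of_nonneg_right hκ (by positivity)).trans (mul_le_mul_of_nonneg_left hd hκ0)
      linarith [hca.2, hcb.1]
    · obtain ⟨d, hd'⟩ : ∃ d, b = a + d := ⟨b - a, by omega⟩
      obtain ⟨h₁, -⟩ := log_partitionFn_sub_log_choose_up_steps_mem_local M M t t' U hβ (l := b) hbM.le d a
        (by omega)
      rw [← hd'] at h₁
      have hd : (d : ℝ) ≤ (M * M : ℕ) := by exact_mod_cast (show d ≤ M * M by omega)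
      rw [hκ'] at h₁
      have h3 : β * (4 * |t| + 4 * |t'| + U) * d ≤ β * (4 * |t| + 4 * |t'| + U) * (M * M : ℕ) :=
        mul_le_mul_of_nonneg_left hd hκ0
      linarith [hca.2, hcb.1]
  rw [spinSectorPressureTT', div_le_iff₀ hM2]
  rw [hMM] at htrans
  have hlog2 : 0 ≤ Real.log 2 := Real.log_nonneg (by norm_num)
  nlinarith [htrans, hdiag, hM2]

/-- **(ii) Tiling**: for `M ≥ 1` and every `k`,
`p_M ≤ p_{(k+1)M} + (β(16|t|+32|t'|) + 4)/M + 2β(4|t|+4|t'|+U)/M²` — the big torus at its own sector is tiled by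
`(k+1)²` small tori carrying `⌊xM²⌋` or `⌊xM²⌋ + 1` up and `⌊yM²⌋` or `⌊yM²⌋ + 1` down electrons each; an extra
electron costs `2 log M + βκ₊` by the volume-free transfer. [cite: Ruelle1969, §3.4] -/
theorem spinSectorPressureTT'_le_tiling (k : ℕ) {M : ℕ} (hM : 1 ≤ M) :
    spinSectorPressureTT' β t t' U x y M ≤ spinSectorPressureTT' β t t' U x y ((k + 1) * M) +
      (β * (16 * |t| + 32 * |t'|) + 4) / M + (2 * (β * (4 * |t| + 4 * |t'| + U))) / (M : ℝ) ^ 2 := by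
  classical
  have hK1 : 1 ≤ k + 1 := Nat.le_add_left 1 k
  have h2x0 : 0 ≤ 2 * x := by linarith
  have h2y0 : 0 ≤ 2 * y := by linarith
  -- the rounding electrons `j↑, j↓ ≤ (k+1)²`
  obtain ⟨hP1, hP2⟩ := sq_mul_halfRectN_le h2x0 (k + 1) M
  obtain ⟨hQ1, hQ2⟩ := sq_mul_halfRectN_le h2y0 (k + 1) M
  set a := halfRectN (2 * x) M with ha
  set b := halfRectN (2 * y) M with hb
  obtain ⟨j, hj, hjle⟩ : ∃ j, halfRectN (2 * x) ((k + 1) * M) = (k + 1) * (k + 1) * a + j ∧ j ≤ (k + 1) * (k + 1) :=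
    ⟨halfRectN (2 * x) ((k + 1) * M) - (k + 1) * (k + 1) * a, by omega, by omega⟩
  obtain ⟨j', hj', hjle'⟩ : ∃ j', halfRectN (2 * y) ((k + 1) * M) = (k + 1) * (k + 1) * b + j' ∧
      j' ≤ (k + 1) * (k + 1) :=
    ⟨halfRectN (2 * y) ((k + 1) * M) - (k + 1) * (k + 1) * b, by omega, by omega⟩
  obtain ⟨s, -, hs⟩ : ∃ s : Finset (Fin (k + 1) × Fin (k + 1)), s ⊆ Finset.univ ∧ s.card = j :=
    Finset.exists_subset_card_eq (by rw [Finset.card_univ, Fintype.card_prod, Fintype.card_fin]; exact hjle)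
  obtain ⟨s', -, hs'⟩ : ∃ s' : Finset (Fin (k + 1) × Fin (k + 1)), s' ⊆ Finset.univ ∧ s'.card = j' :=
    Finset.exists_subset_card_eq (by rw [Finset.card_univ, Fintype.card_prod, Fintype.card_fin]; exact hjle')
  let ps : Fin (k + 1) → Fin (k + 1) → ℕ := fun i i' => a + if (i, i') ∈ s then 1 else 0
  let qs : Fin (k + 1) → Fin (k + 1) → ℕ := fun i i' => b + if (i, i') ∈ s' then 1 else 0
  have hps_apply : ∀ i i', ps i i' = a + if (i, i') ∈ s then 1 else 0 := fun _ _ => rfl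
  have hqs_apply : ∀ i i', qs i i' = b + if (i, i') ∈ s' then 1 else 0 := fun _ _ => rfl
  have hsum_gen : ∀ (c : ℕ) (S : Finset (Fin (k + 1) × Fin (k + 1))),
      ∑ i : Fin (k + 1), ∑ i' : Fin (k + 1), (c + if (i, i') ∈ S then 1 else 0) = (k + 1) * (k + 1) * c + S.card := by
    intro c S
    have h1 : ∑ i : Fin (k + 1), ∑ i' : Fin (k + 1), (c + if (i, i') ∈ S then 1 else 0) =
        ∑ z : Fin (k + 1) × Fin (k + 1), (c + if z ∈ S then 1 else 0) := by
      rw [← Finset.sum_product']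
      rfl
    rw [h1, Finset.sum_add_distrib, Finset.sum_const, Finset.card_univ, Fintype.card_prod, Fintype.card_fin,
      smul_eq_mul, Finset.sum_boole, Finset.filter_mem_eq_inter, Finset.univ_inter]
    simp
  have hsum : ∑ i, ∑ i', ps i i' = halfRectN (2 * x) ((k + 1) * M) := by
    rw [hj, ← hs]; exact hsum_gen a s
  have hsum' : ∑ i, ∑ i', qs i i' = halfRectN (2 * y) ((k + 1) * M) := by
    rw [hj', ← hs']; exact hsum_gen b s'
  -- the small sectors are well inside the small torus
  have haM : a < M * M := halfRectN_lt_sq h2x0 (by linarith) hM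
  have hbM : b < M * M := halfRectN_lt_sq h2y0 (by linarith) hM
  have hpsle : ∀ i i', ps i i' ≤ M * M := fun i i' => by rw [hps_apply]; split_ifs <;> omega
  have hqsle : ∀ i i', qs i i' ≤ M * M := fun i i' => by rw [hqs_apply]; split_ifs <;> omega
  -- positivity of the block partition functions
  have hHM : (hubbardRectTorusTT' M M t t' U).IsHermitian := hubbardRectTorusTT'_isHermitian M M t t' U
  have hZpos : ∀ c c' : ℕ, c ≤ M * M → c' ≤ M * M →
      0 < (partitionFn β (spinSectorHamiltonian c c' (hubbardRectTorusTT' M M t t' U))).re := by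
    intro c c' hc hc'
    have hc1 : c ≤ Fintype.card (Fin M ×ₗ Fin M) := by rw [card_rectSites]; exact hc
    have hc1' : c' ≤ Fintype.card (Fin M ×ₗ Fin M) := by rw [card_rectSites]; exact hc'
    haveI := nonempty_spinConfig (Λ := Fin M ×ₗ Fin M) hc1 hc1'
    exact partitionFn_spinSector_re_pos hHM β
  -- the price `A` of one electron in an `M × M` block (volume-free transfer)
  set A : ℝ := 2 * Real.log M + β * (4 * |t| + 4 * |t'| + U) with hA
  have hMpos : (0 : ℝ) < M := by exact_mod_cast hM
  have hlogM0 : 0 ≤ Real.log M := Real.log_nonneg (by exact_mod_cast hM)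
  have hA0 : 0 ≤ A := by rw [hA]; positivity
  have hMM : ((M * M : ℕ) : ℝ) = (M : ℝ) ^ 2 := by push_cast; ring
  have hent : ∀ c : ℕ, c + 1 ≤ M * M → -(2 * Real.log M) ≤ Real.log ((((M * M : ℕ) : ℝ) - c) / ((c : ℝ) + 1)) := by
    intro c hc
    have hc' : (c : ℝ) + 1 ≤ ((M * M : ℕ) : ℝ) := by exact_mod_cast hc
    have hnum : 1 ≤ ((M * M : ℕ) : ℝ) - c := by linarith
    have hden : (0 : ℝ) < (c : ℝ) + 1 := by positivity
    have h1 : 1 / (M : ℝ) ^ 2 ≤ (((M * M : ℕ) : ℝ) - c) / ((c : ℝ) + 1) := by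
      rw [div_le_div_iff₀ (by positivity) hden]
      rw [hMM] at hc'
      nlinarith
    calc -(2 * Real.log M) = Real.log (1 / (M : ℝ) ^ 2) := by
          rw [one_div, Real.log_inv, Real.log_pow]; push_cast; ring
      _ ≤ _ := Real.log_le_log (by positivity) h1
  have hup : ∀ c c' : ℕ, c + 1 ≤ M * M → c' ≤ M * M →
      Real.log (partitionFn β (spinSectorHamiltonian c c' (hubbardRectTorusTT' M M t t' U))).re - A ≤
        Real.log (partitionFn β (spinSectorHamiltonian (c + 1) c' (hubbardRectTorusTT' M M t t' U))).re := by
    intro c c' hc hc'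
    obtain ⟨h₁, -⟩ := log_partitionFn_spinSector_hubbardRectTorusTT'_succ_up_mem_local M M t t' U hβ hc hc'
    rw [max_eq_left hU] at h₁
    have := hent c hc
    rw [hA]; linarith
  have hdown : ∀ c c' : ℕ, c ≤ M * M → c' + 1 ≤ M * M →
      Real.log (partitionFn β (spinSectorHamiltonian c c' (hubbardRectTorusTT' M M t t' U))).re - A ≤
        Real.log (partitionFn β (spinSectorHamiltonian c (c' + 1) (hubbardRectTorusTT' M M t t' U))).re := by
    intro c c' hc hc'
    obtain ⟨h₁, -⟩ := log_partitionFn_spinSector_hubbardRectTorusTT'_succ_down_mem_local M M t t' U hβ hc hc'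
    rw [max_eq_left hU] at h₁
    have := hent c' hc'
    rw [hA]; linarith
  -- every block: `log Z(ps, qs) ≥ log Z(a, b) − 2A`
  have hblock : ∀ i i', Real.log (partitionFn β (spinSectorHamiltonian a b (hubbardRectTorusTT' M M t t' U))).re
      - 2 * A ≤
      Real.log (partitionFn β (spinSectorHamiltonian (ps i i') (qs i i') (hubbardRectTorusTT' M M t t' U))).re := by
    intro i i'
    have hstep1 : Real.log (partitionFn β (spinSectorHamiltonian a b (hubbardRectTorusTT' M M t t' U))).re - A ≤
        Real.log (partitionFn β (spinSectorHamiltonian (ps i i') b (hubbardRectTorusTT' M M t t' U))).re := by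
      by_cases hmem : (i, i') ∈ s
      · have e : ps i i' = a + 1 := by rw [hps_apply, if_pos hmem]
        rw [e]; exact hup a b (by omega) hbM.le
      · have e : ps i i' = a := by rw [hps_apply, if_neg hmem, add_zero]
        rw [e]; linarith
    have hstep2 : Real.log (partitionFn β (spinSectorHamiltonian (ps i i') b (hubbardRectTorusTT' M M t t' U))).re
        - A ≤
        Real.log (partitionFn β (spinSectorHamiltonian (ps i i') (qs i i') (hubbardRectTorusTT' M M t t' U))).re := by
      by_cases hmem : (i, i') ∈ s'
      · have e : qs i i' = b + 1 := by rw [hqs_apply, if_pos hmem]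
        rw [e]; exact hdown (ps i i') b (hpsle i i') (by omega)
      · have e : qs i i' = b := by rw [hqs_apply, if_neg hmem, add_zero]
        rw [e]; linarith
    linarith
  -- the squares inequality, in logarithmic form
  have hsq := prod_partitionFn_hubbardRectTorusTT'_squares_le M t t' U hβ k ps qs
  rw [hsum, hsum'] at hsq
  have hprodpos : 0 < ∏ i, ∏ i', (partitionFn β (spinSectorHamiltonian (ps i i') (qs i i')
      (hubbardRectTorusTT' M M t t' U))).re :=
    Finset.prod_pos fun i _ => Finset.prod_pos fun i' _ => hZpos _ _ (hpsle i i') (hqsle i i')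
  have hlog := Real.log_le_log (mul_pos (Real.exp_pos _) hprodpos) hsq
  have hlogprod : Real.log (∏ i, ∏ i', (partitionFn β (spinSectorHamiltonian (ps i i') (qs i i')
      (hubbardRectTorusTT' M M t t' U))).re) =
      ∑ i, ∑ i', Real.log (partitionFn β (spinSectorHamiltonian (ps i i') (qs i i')
        (hubbardRectTorusTT' M M t t' U))).re := by
    rw [Real.log_prod (fun i _ => (Finset.prod_pos fun i' _ => hZpos _ _ (hpsle i i') (hqsle i i')).ne')]
    refine Finset.sum_congr rfl fun i _ => ?_
    rw [Real.log_prod (fun i' _ => (hZpos _ _ (hpsle i i') (hqsle i i')).ne')]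
  rw [Real.log_mul (Real.exp_pos _).ne' hprodpos.ne', Real.log_exp, hlogprod] at hlog
  -- sum the block bounds
  have hsumblock : ((k + 1 : ℕ) : ℝ) * (((k + 1 : ℕ) : ℝ) *
      (Real.log (partitionFn β (spinSectorHamiltonian a b (hubbardRectTorusTT' M M t t' U))).re - 2 * A)) ≤
      ∑ i : Fin (k + 1), ∑ i' : Fin (k + 1),
        Real.log (partitionFn β (spinSectorHamiltonian (ps i i') (qs i i') (hubbardRectTorusTT' M M t t' U))).re := by
    have h := Finset.sum_le_sum fun i (_ : i ∈ Finset.univ) =>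
      Finset.sum_le_sum fun i' (_ : i' ∈ Finset.univ) => hblock i i'
    simp only [Finset.sum_const, Finset.card_univ, Fintype.card_fin, nsmul_eq_mul] at h
    exact h
  -- per-volume identities
  have hKpos : (0 : ℝ) < ((k + 1 : ℕ) : ℝ) := by exact_mod_cast hK1
  have epM : spinSectorPressureTT' β t t' U x y M =
      Real.log (partitionFn β (spinSectorHamiltonian a b (hubbardRectTorusTT' M M t t' U))).re / (M : ℝ) ^ 2 := rfl
  have epK : spinSectorPressureTT' β t t' U x y ((k + 1) * M) =
      Real.log (partitionFn β (spinSectorHamiltonian (halfRectN (2 * x) ((k + 1) * M))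
        (halfRectN (2 * y) ((k + 1) * M))
        (hubbardRectTorusTT' ((k + 1) * M) ((k + 1) * M) t t' U))).re / ((((k + 1) * M : ℕ) : ℝ)) ^ 2 := rfl
  -- the constant `2A ≤ 4M + D` and the division by `((k+1)M)²`
  have hAbound : 2 * A ≤ 4 * M + 2 * (β * (4 * |t| + 4 * |t'| + U)) := by
    rw [hA]
    have := Real.log_le_sub_one_of_pos hMpos
    linarith
  have hk : (k : ℝ) + 1 = ((k + 1 : ℕ) : ℝ) := by push_cast; ring
  have hineq : -(β * (16 * |t| + 32 * |t'|) * M * k * (k + 1)) +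
      ((k + 1 : ℕ) : ℝ) * (((k + 1 : ℕ) : ℝ) *
        (Real.log (partitionFn β (spinSectorHamiltonian a b (hubbardRectTorusTT' M M t t' U))).re - 2 * A)) ≤
      Real.log (partitionFn β (spinSectorHamiltonian (halfRectN (2 * x) ((k + 1) * M))
        (halfRectN (2 * y) ((k + 1) * M)) (hubbardRectTorusTT' ((k + 1) * M) ((k + 1) * M) t t' U))).re := by
    have e : β * (16 * |t| + 32 * |t'|) * M * k * (k + 1) = β * ((16 * |t| + 32 * |t'|) * M * k * (k + 1)) := by ring
    rw [e]
    linarith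
  have hfin := tiling_div_step hMpos hKpos hk hAbound (by positivity) hineq
  rw [epM, epK]
  push_cast at hfin ⊢
  exact hfin

/-- **(iii) Filling**: for `M₀ ≤ ℓ ≤ L` with `M₀ ≥ 1/(2−2x), 1/(2−2y)`,
`L² (−p_L) ≤ ℓ² (−p_ℓ) + C (L² − ℓ² + L)`, `C = β(16|t|+32|t'|) + 2βU + 4` — the big torus at its own sector contains
the corner torus at its own sector plus the extra electrons of both species parked in the complement.
[cite: Ruelle1969, §2.2] -/
theorem sq_mul_neg_spinSectorPressureTT'_le_filling {M₀ : ℕ} (hM₀1 : 1 ≤ M₀) (hM₀x : 1 / (2 - 2 * x) ≤ M₀)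
    (hM₀y : 1 / (2 - 2 * y) ≤ M₀) {ℓ L : ℕ} (hℓ : M₀ ≤ ℓ) (hℓL : ℓ ≤ L) :
    (L : ℝ) ^ 2 * (-spinSectorPressureTT' β t t' U x y L) ≤
      (ℓ : ℝ) ^ 2 * (-spinSectorPressureTT' β t t' U x y ℓ) +
        (β * (16 * |t| + 32 * |t'|) + 2 * (β * U) + 4) * ((L : ℝ) ^ 2 - (ℓ : ℝ) ^ 2 + L) := by
  have hℓ1 : 1 ≤ ℓ := hM₀1.trans hℓ
  have hL1 : 1 ≤ L := hℓ1.trans hℓL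
  have h2x0 : 0 ≤ 2 * x := by linarith
  have h2y0 : 0 ≤ 2 * y := by linarith
  have h2x2 : 2 * x < 2 := by linarith
  have h2y2 : 2 * y < 2 := by linarith
  obtain ⟨r, rfl⟩ : ∃ r, L = ℓ + r := ⟨L - ℓ, by omega⟩
  obtain ⟨hmono, hq⟩ := halfRectN_sub_le_complement h2x0 h2x2 hM₀x hℓ r
  obtain ⟨hmono', hq'⟩ := halfRectN_sub_le_complement h2y0 h2y2 hM₀y hℓ r
  set q : ℕ := halfRectN (2 * x) (ℓ + r) - halfRectN (2 * x) ℓ with hqdef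
  set q' : ℕ := halfRectN (2 * y) (ℓ + r) - halfRectN (2 * y) ℓ with hqdef'
  have hsplit : halfRectN (2 * x) (ℓ + r) = halfRectN (2 * x) ℓ + q := by omega
  have hsplit' : halfRectN (2 * y) (ℓ + r) = halfRectN (2 * y) ℓ + q' := by omega
  have hfill := partitionFn_hubbardRectTorusTT'_square_fill₂ ℓ r t t' U hβ (halfRectN (2 * x) ℓ)
    (halfRectN (2 * y) ℓ) hq hq'
  rw [← hsplit, ← hsplit', max_eq_left hU] at hfill
  -- positivity of the two partition functions
  have hcardℓ : ∀ {n : ℝ}, 0 ≤ n → n < 2 → halfRectN n ℓ ≤ Fintype.card (Fin ℓ ×ₗ Fin ℓ) := fun hn0 hn2 => by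
    rw [card_rectSites]; exact (halfRectN_lt_sq hn0 hn2 hℓ1).le
  have hcardL : ∀ {n : ℝ}, 0 ≤ n → n < 2 → halfRectN n (ℓ + r) ≤ Fintype.card (Fin (ℓ + r) ×ₗ Fin (ℓ + r)) :=
    fun hn0 hn2 => by rw [card_rectSites]; exact (halfRectN_lt_sq hn0 hn2 hL1).le
  haveI := nonempty_spinConfig (Λ := Fin ℓ ×ₗ Fin ℓ) (hcardℓ h2x0 h2x2) (hcardℓ h2y0 h2y2)
  haveI := nonempty_spinConfig (Λ := Fin (ℓ + r) ×ₗ Fin (ℓ + r)) (hcardL h2x0 h2x2) (hcardL h2y0 h2y2)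
  have hZℓ : 0 < (partitionFn β (spinSectorHamiltonian (halfRectN (2 * x) ℓ) (halfRectN (2 * y) ℓ)
      (hubbardRectTorusTT' ℓ ℓ t t' U))).re :=
    partitionFn_spinSector_re_pos (hubbardRectTorusTT'_isHermitian ℓ ℓ t t' U) β
  have hZL : 0 < (partitionFn β (spinSectorHamiltonian (halfRectN (2 * x) (ℓ + r)) (halfRectN (2 * y) (ℓ + r))
      (hubbardRectTorusTT' (ℓ + r) (ℓ + r) t t' U))).re :=
    partitionFn_spinSector_re_pos (hubbardRectTorusTT'_isHermitian _ _ t t' U) β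
  have hlog := Real.log_le_log (mul_pos (Real.exp_pos _) hZℓ) hfill
  rw [Real.log_mul (Real.exp_pos _).ne' hZℓ.ne', Real.log_exp] at hlog
  -- per-volume identities
  have hℓpos : (0 : ℝ) < ℓ := by exact_mod_cast hℓ1
  have hLpos : (0 : ℝ) < ((ℓ + r : ℕ) : ℝ) := by exact_mod_cast hL1
  rw [spinSectorPressureTT', spinSectorPressureTT', mul_neg, mul_neg,
    mul_div_cancel₀ _ (by positivity), mul_div_cancel₀ _ (by positivity)]
  -- the cost: `β((8|t|+16|t'|)(2ℓ+r) + U (q + q')) ≤ C (L² − ℓ² + L)`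
  have hqR : (q : ℝ) ≤ r * ℓ + r * (ℓ + r) := by exact_mod_cast hq
  have hqR' : (q' : ℝ) ≤ r * ℓ + r * (ℓ + r) := by exact_mod_cast hq'
  have hr0 : (0 : ℝ) ≤ r := by positivity
  have hG : (r : ℝ) * ℓ + r * (ℓ + r) = ((ℓ : ℝ) + r) ^ 2 - (ℓ : ℝ) ^ 2 := by ring
  rw [hG] at hqR hqR'
  have hcost := fill_cost_arith (t := t) (t' := t') hβ hU hℓpos.le hr0 hqR hqR'
  push_cast at hlog ⊢
  linarith [hlog, hcost]

/-- **Existence of the thermodynamic limit of the spin-resolved canonical pressure** (`β ≥ 0`, `U ≥ 0`,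
`x, y ∈ [0, 1)`): `L⁻² log Re Z_β(hubbardRectTorusTT' L L; ⌊xL²⌋, ⌊yL²⌋)` converges as `L → ∞` — Fekete along squares
fed by the a-priori ceiling, the torus tiling with the volume-free price of the rounding electrons, and the complement
filling. [cite: Ruelle1969, §3.4] [cite: Israel1979, Thm. I.2.4] -/
theorem exists_tendsto_spinSectorPressureTT' :
    ∃ π : ℝ, Tendsto (fun L : ℕ => spinSectorPressureTT' β t t' U x y L) atTop (𝓝 π) := by
  have h2x : 0 < 2 - 2 * x := by linarith
  have h2y : 0 < 2 - 2 * y := by linarith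
  set M₀ : ℕ := ⌈1 / (2 - 2 * x)⌉₊ + ⌈1 / (2 - 2 * y)⌉₊ + 1 with hM₀
  have hM₀1 : 1 ≤ M₀ := Nat.le_add_left 1 _
  have hM₀x : 1 / (2 - 2 * x) ≤ M₀ := by
    have := Nat.le_ceil (1 / (2 - 2 * x))
    have h0 : (0 : ℝ) ≤ ⌈1 / (2 - 2 * y)⌉₊ := by positivity
    rw [hM₀]; push_cast; linarith
  have hM₀y : 1 / (2 - 2 * y) ≤ M₀ := by
    have := Nat.le_ceil (1 / (2 - 2 * y))
    have h0 : (0 : ℝ) ≤ ⌈1 / (2 - 2 * x)⌉₊ := by positivity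
    rw [hM₀]; push_cast; linarith
  set b : ℕ → ℝ := fun L => -spinSectorPressureTT' β t t' U x y L with hb
  have hC : 0 ≤ β * (16 * |t| + 32 * |t'|) + 2 * (β * U) + 4 := by positivity
  have hD : 0 ≤ 2 * (β * (4 * |t| + 4 * |t'| + U)) := by positivity
  obtain ⟨e, he⟩ := tendsto_of_tiling_of_filling b (C := β * (16 * |t| + 32 * |t'|) + 2 * (β * U) + 4)
    (D := 2 * (β * (4 * |t| + 4 * |t'| + U)))
    (c := Real.log 4 + β * (8 * |t| + 8 * |t'|) + Real.log 2 + β * (4 * |t| + 4 * |t'| + U))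
    hM₀1 hC hD
    (fun M hM => by
      have h := spinSectorPressureTT'_le_apriori hβ t t' hU hx0 hx1 hy0 hy1 (hM₀1.trans hM)
      simp only [hb]; linarith)
    (fun k M hM => by
      have h := spinSectorPressureTT'_le_tiling hβ t t' hU hx0 hx1 hy0 hy1 k (hM₀1.trans hM)
      have hMpos : (0 : ℝ) < M := by exact_mod_cast hM₀1.trans hM
      have hextra : (β * (16 * |t| + 32 * |t'|) + 4) / (M : ℝ) ≤
          (β * (16 * |t| + 32 * |t'|) + 2 * (β * U) + 4) / M :=
        div_le_div_of_nonneg_right (by nlinarith [mul_nonneg hβ hU]) hMpos.le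
      simp only [hb]; linarith)
    (fun ℓ L hℓ hℓL => by
      have h := sq_mul_neg_spinSectorPressureTT'_le_filling hβ t t' hU hx0 hx1 hy0 hy1 hM₀1 hM₀x hM₀y hℓ hℓL
      simp only [hb]; linarith)
  refine ⟨-e, ?_⟩
  have h := he.neg
  simp only [hb, neg_neg] at h
  exact h

end Fekete

/-! ### §3 The spin-resolved thermal pressure as ONE number -/

/-- **The spin-resolved thermal pressure (free entropy per site) of the two-dimensional `t–t'` Hubbard model** at
inverse temperature `β`, couplings `(t, t', U)` and spin densities `(x, y) = (n↑, n↓)`: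
`p(β; t,t',U; x, y) = lim_{L→∞} L⁻² log Re Z_β(hubbardRectTorusTT' L L t t' U; ⌊xL²⌋, ⌊yL²⌋)` (`limUnder`; the limit
exists for `β ≥ 0`, `U ≥ 0`, `x, y ∈ [0,1)` by `exists_tendsto_spinSectorPressureTT'`). Its diagonal is the canonical
number of record `pressureTT'` (`pressureTT'₂_half_half`). [cite: Israel1979, Thm. I.2.4] [cite: Ruelle1969, §3.4] -/
def pressureTT'₂ (β t t' U x y : ℝ) : ℝ :=
  limUnder atTop (fun L : ℕ => spinSectorPressureTT' β t t' U x y L)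

section Limit

variable {β : ℝ} (hβ : 0 ≤ β) (t t' : ℝ) {U : ℝ} (hU : 0 ≤ U) {x y : ℝ} (hx0 : 0 ≤ x) (hx1 : x < 1)
  (hy0 : 0 ≤ y) (hy1 : y < 1)
include hβ hU hx0 hx1 hy0 hy1

/-- **The defining limit**: `p_L(x,y) → p(β; t,t',U; x, y)` (`β ≥ 0`, `U ≥ 0`, `x, y ∈ [0,1)`).
[cite: Israel1979, Thm. I.2.4] -/
theorem tendsto_spinSectorPressureTT' :
    Tendsto (fun L : ℕ => spinSectorPressureTT' β t t' U x y L) atTop (𝓝 (pressureTT'₂ β t t' U x y)) :=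
  tendsto_nhds_limUnder (exists_tendsto_spinSectorPressureTT' hβ t t' hU hx0 hx1 hy0 hy1)

/-- The limit in the `log Z / L²` form along every side sequence `Ls → ∞`. [cite: Israel1979, Thm. I.2.4] -/
theorem tendsto_log_partitionFn_spinSector_div_sq_comp {Ls : ℕ → ℕ} (hLs : Tendsto Ls atTop atTop) :
    Tendsto (fun j : ℕ => Real.log (partitionFn β (spinSectorHamiltonian (halfRectN (2 * x) (Ls j))
      (halfRectN (2 * y) (Ls j)) (hubbardRectTorusTT' (Ls j) (Ls j) t t' U))).re / ((Ls j : ℕ) : ℝ) ^ 2) atTop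
      (𝓝 (pressureTT'₂ β t t' U x y)) :=
  (tendsto_spinSectorPressureTT' hβ t t' hU hx0 hx1 hy0 hy1).comp hLs

/-- **A-priori ceiling for the number**: `p(x,y) ≤ log 4 + β(8|t|+8|t'|) + log 2 + β(4|t|+4|t'|+U)`.
[cite: Ruelle1969, §3.3] -/
theorem pressureTT'₂_le_apriori :
    pressureTT'₂ β t t' U x y ≤ Real.log 4 + β * (8 * |t| + 8 * |t'|) + Real.log 2 + β * (4 * |t| + 4 * |t'| + U) :=
  le_of_tendsto (tendsto_spinSectorPressureTT' hβ t t' hU hx0 hx1 hy0 hy1)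
    (eventually_atTop.2 ⟨1, fun _ hM => spinSectorPressureTT'_le_apriori hβ t t' hU hx0 hx1 hy0 hy1 hM⟩)

end Limit

/-- **The diagonal is the canonical number of record**: `p(β; t,t',U; n/2, n/2) = pressureTT' β t t' U n`
(`β ≥ 0`, `U ≥ 0`, `0 ≤ n < 2`). [cite: Israel1979, Thm. I.2.4] -/
theorem pressureTT'₂_half_half {β : ℝ} (hβ : 0 ≤ β) (t t' : ℝ) {U : ℝ} (hU : 0 ≤ U) {n : ℝ} (hn0 : 0 ≤ n)
    (hn2 : n < 2) : pressureTT'₂ β t t' U (n / 2) (n / 2) = pressureTT' β t t' U n := by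
  have h1 := tendsto_spinSectorPressureTT' hβ t t' hU (x := n / 2) (y := n / 2) (by linarith) (by linarith)
    (by linarith) (by linarith)
  have h2 := tendsto_sectorPressureTT' hβ t t' hU hn0 hn2
  simp_rw [spinSectorPressureTT'_half_half] at h1
  exact tendsto_nhds_unique h1 h2

/-! ### §4 The spin-resolved density legs: `n_σ ↦ p − H_b(n_σ)` is `βκ`-Lipschitz -/

section DensityLegs

/-- `k_L` is monotone in the density. [folklore] -/
private theorem halfRectN_mono'' {x y : ℝ} (hxy : x ≤ y) (L : ℕ) : halfRectN x L ≤ halfRectN y L := by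
  unfold halfRectN
  exact Nat.floor_le_floor (by nlinarith [sq_nonneg (L : ℝ)])

/-- `k_L(n)/L² → n/2`. [folklore] -/
private theorem tendsto_halfRectN_div_sq''' {n : ℝ} (hn0 : 0 ≤ n) :
    Tendsto (fun L : ℕ => (halfRectN n L : ℝ) / (L : ℝ) ^ 2) atTop (𝓝 (n / 2)) := by
  have h := (tendsto_rectN_div_sq hn0).div_const 2
  refine h.congr fun L => ?_
  have e : rectN n L = 2 * halfRectN n L := rfl
  rw [e]
  push_cast
  ring

/-- The one-species binomial entropy density: `L⁻² log C(L², ⌊xL²⌋) → H_b(x)` for `x ∈ [0,1)` (half of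
`p_L(0; 2x) → 2H_b(x)`). [cite: Israel1979, Lemma II.3.1] -/
theorem tendsto_log_choose_halfRectN_div_sq {x : ℝ} (hx0 : 0 ≤ x) (hx1 : x < 1) :
    Tendsto (fun L : ℕ => Real.log ((L * L).choose (halfRectN (2 * x) L)) / (L : ℝ) ^ 2) atTop
      (𝓝 (Real.binEntropy x)) := by
  have h2x0 : 0 ≤ 2 * x := by linarith
  have h2x2 : 2 * x < 2 := by linarith
  have h := tendsto_sectorPressureTT' le_rfl 0 0 le_rfl h2x0 h2x2
  rw [pressureTT'_zero 0 0 le_rfl h2x0 h2x2, show 2 * x / 2 = x by ring] at h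
  have h' := h.const_mul (1 / 2)
  rw [show 1 / 2 * (2 * Real.binEntropy x) = Real.binEntropy x by ring] at h'
  refine (h'.congr' ?_)
  filter_upwards [eventually_ge_atTop 1] with L hL
  have hL2 : (0 : ℝ) < (L : ℝ) ^ 2 := by
    have : (1 : ℝ) ≤ L := by exact_mod_cast hL
    positivity
  rw [sectorPressureTT'_zero, sectorGibbsCount_eq_choose_sq, sq L, Nat.cast_pow, Real.log_pow]
  push_cast
  ring

variable {β : ℝ} (hβ : 0 ≤ β) (t t' : ℝ) {U : ℝ} (hU : 0 ≤ U)
include hβ hU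

/-- **The up-density leg** (`β ≥ 0`, `U ≥ 0`, `0 ≤ x ≤ x' < 1`, `0 ≤ y < 1`):
`−β(4|t|+4|t'|+U)(x' − x) ≤ [p(x',y) − H_b(x')] − [p(x,y) − H_b(x)] ≤ β(4|t|+4|t'|)(x' − x)` — adding up electrons
changes the interaction free entropy within the one-particle band; `βμ↑ = −∂p/∂n↑ ∈ log(x/(1−x)) + β[−(4|t|+4|t'|), 4|t|+4|t'|+U]`.
[cite: Ruelle1969, §3.4] -/
theorem pressureTT'₂_sub_binEntropy_sub_mem_fst {x x' y : ℝ} (hx0 : 0 ≤ x) (hxx' : x ≤ x') (hx'1 : x' < 1)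
    (hy0 : 0 ≤ y) (hy1 : y < 1) :
    -(β * (4 * |t| + 4 * |t'| + U) * (x' - x)) ≤
        (pressureTT'₂ β t t' U x' y - Real.binEntropy x') - (pressureTT'₂ β t t' U x y - Real.binEntropy x) ∧
      (pressureTT'₂ β t t' U x' y - Real.binEntropy x') - (pressureTT'₂ β t t' U x y - Real.binEntropy x) ≤
        β * (4 * |t| + 4 * |t'|) * (x' - x) := by
  have hx1 : x < 1 := lt_of_le_of_lt hxx' hx'1
  have hx'0 : 0 ≤ x' := hx0.trans hxx'
  -- the finite-volume brackets
  have hfin : ∀ L : ℕ, 1 ≤ L →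
      -(β * (4 * |t| + 4 * |t'| + U) * (((halfRectN (2 * x') L : ℝ) - halfRectN (2 * x) L) / (L : ℝ) ^ 2)) ≤
        (spinSectorPressureTT' β t t' U x' y L - Real.log ((L * L).choose (halfRectN (2 * x') L)) / (L : ℝ) ^ 2) -
          (spinSectorPressureTT' β t t' U x y L - Real.log ((L * L).choose (halfRectN (2 * x) L)) / (L : ℝ) ^ 2) ∧
      (spinSectorPressureTT' β t t' U x' y L - Real.log ((L * L).choose (halfRectN (2 * x') L)) / (L : ℝ) ^ 2) -
          (spinSectorPressureTT' β t t' U x y L - Real.log ((L * L).choose (halfRectN (2 * x) L)) / (L : ℝ) ^ 2) ≤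
        β * (4 * |t| + 4 * |t'|) * (((halfRectN (2 * x') L : ℝ) - halfRectN (2 * x) L) / (L : ℝ) ^ 2) := by
    intro L hL
    have hL2 : (0 : ℝ) < (L : ℝ) ^ 2 := by
      have : (1 : ℝ) ≤ L := by exact_mod_cast hL
      positivity
    have hk : halfRectN (2 * x) L ≤ halfRectN (2 * x') L := halfRectN_mono'' (by linarith) L
    obtain ⟨d, hd⟩ : ∃ d, halfRectN (2 * x') L = halfRectN (2 * x) L + d := ⟨_, (Nat.add_sub_cancel' hk).symm⟩
    have htop : halfRectN (2 * x) L + d ≤ L * L := by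
      rw [← hd]; exact (halfRectN_lt_sq (by linarith) (by linarith) hL).le
    have hl : halfRectN (2 * y) L ≤ L * L := (halfRectN_lt_sq (by linarith) (by linarith) hL).le
    obtain ⟨h₁, h₂⟩ := log_partitionFn_sub_log_choose_up_steps_mem_local L L t t' U hβ hl d (halfRectN (2 * x) L)
      htop
    rw [← hd, max_eq_left hU] at h₁
    rw [← hd, max_eq_right (by linarith : -U ≤ 0), add_zero] at h₂
    have hdR : (d : ℝ) = (halfRectN (2 * x') L : ℝ) - halfRectN (2 * x) L := by rw [hd]; push_cast; ring
    rw [hdR] at h₁ h₂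
    have key : (spinSectorPressureTT' β t t' U x' y L - Real.log ((L * L).choose (halfRectN (2 * x') L)) / (L : ℝ) ^ 2)
        - (spinSectorPressureTT' β t t' U x y L - Real.log ((L * L).choose (halfRectN (2 * x) L)) / (L : ℝ) ^ 2) =
        ((Real.log (partitionFn β (spinSectorHamiltonian (halfRectN (2 * x') L) (halfRectN (2 * y) L)
            (hubbardRectTorusTT' L L t t' U))).re - Real.log ((L * L).choose (halfRectN (2 * x') L))) -
          (Real.log (partitionFn β (spinSectorHamiltonian (halfRectN (2 * x) L) (halfRectN (2 * y) L)
            (hubbardRectTorusTT' L L t t' U))).re - Real.log ((L * L).choose (halfRectN (2 * x) L)))) /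
          (L : ℝ) ^ 2 := by
      unfold spinSectorPressureTT'
      field_simp
    rw [key]
    constructor
    · rw [show -(β * (4 * |t| + 4 * |t'| + U) * (((halfRectN (2 * x') L : ℝ) - halfRectN (2 * x) L) / (L : ℝ) ^ 2))
          = -(β * (4 * |t| + 4 * |t'| + U) * ((halfRectN (2 * x') L : ℝ) - halfRectN (2 * x) L)) / (L : ℝ) ^ 2
          by ring]
      exact div_le_div_of_nonneg_right h₁ hL2.le
    · rw [show β * (4 * |t| + 4 * |t'|) * (((halfRectN (2 * x') L : ℝ) - halfRectN (2 * x) L) / (L : ℝ) ^ 2)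
          = β * (4 * |t| + 4 * |t'|) * ((halfRectN (2 * x') L : ℝ) - halfRectN (2 * x) L) / (L : ℝ) ^ 2 by ring]
      exact div_le_div_of_nonneg_right h₂ hL2.le
  -- the limits
  have hF : Tendsto (fun L : ℕ =>
      (spinSectorPressureTT' β t t' U x' y L - Real.log ((L * L).choose (halfRectN (2 * x') L)) / (L : ℝ) ^ 2) -
        (spinSectorPressureTT' β t t' U x y L - Real.log ((L * L).choose (halfRectN (2 * x) L)) / (L : ℝ) ^ 2))
      atTop (𝓝 ((pressureTT'₂ β t t' U x' y - Real.binEntropy x') - (pressureTT'₂ β t t' U x y - Real.binEntropy x))) :=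
    ((tendsto_spinSectorPressureTT' hβ t t' hU hx'0 hx'1 hy0 hy1).sub (tendsto_log_choose_halfRectN_div_sq hx'0 hx'1)).sub
      ((tendsto_spinSectorPressureTT' hβ t t' hU hx0 hx1 hy0 hy1).sub (tendsto_log_choose_halfRectN_div_sq hx0 hx1))
  have hk : Tendsto (fun L : ℕ => ((halfRectN (2 * x') L : ℝ) - halfRectN (2 * x) L) / (L : ℝ) ^ 2) atTop
      (𝓝 (x' - x)) := by
    have h := (tendsto_halfRectN_div_sq''' (n := 2 * x') (by linarith)).sub
      (tendsto_halfRectN_div_sq''' (n := 2 * x) (by linarith))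
    rw [show x' - x = 2 * x' / 2 - 2 * x / 2 by ring]
    refine h.congr fun L => ?_
    rw [sub_div]
  constructor
  · have hG := (hk.const_mul (β * (4 * |t| + 4 * |t'| + U))).neg
    exact le_of_tendsto_of_tendsto hG hF (eventually_atTop.2 ⟨1, fun L hL => (hfin L hL).1⟩)
  · have hG := hk.const_mul (β * (4 * |t| + 4 * |t'|))
    exact le_of_tendsto_of_tendsto hF hG (eventually_atTop.2 ⟨1, fun L hL => (hfin L hL).2⟩)

/-- **The down-density leg** (`0 ≤ y ≤ y' < 1`, `0 ≤ x < 1`):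
`−β(4|t|+4|t'|+U)(y' − y) ≤ [p(x,y') − H_b(y')] − [p(x,y) − H_b(y)] ≤ β(4|t|+4|t'|)(y' − y)`. [cite: Ruelle1969, §3.4] -/
theorem pressureTT'₂_sub_binEntropy_sub_mem_snd {x y y' : ℝ} (hx0 : 0 ≤ x) (hx1 : x < 1) (hy0 : 0 ≤ y)
    (hyy' : y ≤ y') (hy'1 : y' < 1) :
    -(β * (4 * |t| + 4 * |t'| + U) * (y' - y)) ≤
        (pressureTT'₂ β t t' U x y' - Real.binEntropy y') - (pressureTT'₂ β t t' U x y - Real.binEntropy y) ∧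
      (pressureTT'₂ β t t' U x y' - Real.binEntropy y') - (pressureTT'₂ β t t' U x y - Real.binEntropy y) ≤
        β * (4 * |t| + 4 * |t'|) * (y' - y) := by
  have hy1 : y < 1 := lt_of_le_of_lt hyy' hy'1
  have hy'0 : 0 ≤ y' := hy0.trans hyy'
  have hfin : ∀ L : ℕ, 1 ≤ L →
      -(β * (4 * |t| + 4 * |t'| + U) * (((halfRectN (2 * y') L : ℝ) - halfRectN (2 * y) L) / (L : ℝ) ^ 2)) ≤
        (spinSectorPressureTT' β t t' U x y' L - Real.log ((L * L).choose (halfRectN (2 * y') L)) / (L : ℝ) ^ 2) -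
          (spinSectorPressureTT' β t t' U x y L - Real.log ((L * L).choose (halfRectN (2 * y) L)) / (L : ℝ) ^ 2) ∧
      (spinSectorPressureTT' β t t' U x y' L - Real.log ((L * L).choose (halfRectN (2 * y') L)) / (L : ℝ) ^ 2) -
          (spinSectorPressureTT' β t t' U x y L - Real.log ((L * L).choose (halfRectN (2 * y) L)) / (L : ℝ) ^ 2) ≤
        β * (4 * |t| + 4 * |t'|) * (((halfRectN (2 * y') L : ℝ) - halfRectN (2 * y) L) / (L : ℝ) ^ 2) := by
    intro L hL
    have hL2 : (0 : ℝ) < (L : ℝ) ^ 2 := by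
      have : (1 : ℝ) ≤ L := by exact_mod_cast hL
      positivity
    have hk : halfRectN (2 * y) L ≤ halfRectN (2 * y') L := halfRectN_mono'' (by linarith) L
    obtain ⟨d, hd⟩ : ∃ d, halfRectN (2 * y') L = halfRectN (2 * y) L + d := ⟨_, (Nat.add_sub_cancel' hk).symm⟩
    have htop : halfRectN (2 * y) L + d ≤ L * L := by
      rw [← hd]; exact (halfRectN_lt_sq (by linarith) (by linarith) hL).le
    have hkx : halfRectN (2 * x) L ≤ L * L := (halfRectN_lt_sq (by linarith) (by linarith) hL).le
    obtain ⟨h₁, h₂⟩ := log_partitionFn_sub_log_choose_down_steps_mem_local L L t t' U hβ hkx d (halfRectN (2 * y) L)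
      htop
    rw [← hd, max_eq_left hU] at h₁
    rw [← hd, max_eq_right (by linarith : -U ≤ 0), add_zero] at h₂
    have hdR : (d : ℝ) = (halfRectN (2 * y') L : ℝ) - halfRectN (2 * y) L := by rw [hd]; push_cast; ring
    rw [hdR] at h₁ h₂
    have key : (spinSectorPressureTT' β t t' U x y' L - Real.log ((L * L).choose (halfRectN (2 * y') L)) / (L : ℝ) ^ 2)
        - (spinSectorPressureTT' β t t' U x y L - Real.log ((L * L).choose (halfRectN (2 * y) L)) / (L : ℝ) ^ 2) =
        ((Real.log (partitionFn β (spinSectorHamiltonian (halfRectN (2 * x) L) (halfRectN (2 * y') L)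
            (hubbardRectTorusTT' L L t t' U))).re - Real.log ((L * L).choose (halfRectN (2 * y') L))) -
          (Real.log (partitionFn β (spinSectorHamiltonian (halfRectN (2 * x) L) (halfRectN (2 * y) L)
            (hubbardRectTorusTT' L L t t' U))).re - Real.log ((L * L).choose (halfRectN (2 * y) L)))) /
          (L : ℝ) ^ 2 := by
      unfold spinSectorPressureTT'
      field_simp
    rw [key]
    constructor
    · rw [show -(β * (4 * |t| + 4 * |t'| + U) * (((halfRectN (2 * y') L : ℝ) - halfRectN (2 * y) L) / (L : ℝ) ^ 2))
          = -(β * (4 * |t| + 4 * |t'| + U) * ((halfRectN (2 * y') L : ℝ) - halfRectN (2 * y) L)) / (L : ℝ) ^ 2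
          by ring]
      exact div_le_div_of_nonneg_right h₁ hL2.le
    · rw [show β * (4 * |t| + 4 * |t'|) * (((halfRectN (2 * y') L : ℝ) - halfRectN (2 * y) L) / (L : ℝ) ^ 2)
          = β * (4 * |t| + 4 * |t'|) * ((halfRectN (2 * y') L : ℝ) - halfRectN (2 * y) L) / (L : ℝ) ^ 2 by ring]
      exact div_le_div_of_nonneg_right h₂ hL2.le
  have hF : Tendsto (fun L : ℕ =>
      (spinSectorPressureTT' β t t' U x y' L - Real.log ((L * L).choose (halfRectN (2 * y') L)) / (L : ℝ) ^ 2) -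
        (spinSectorPressureTT' β t t' U x y L - Real.log ((L * L).choose (halfRectN (2 * y) L)) / (L : ℝ) ^ 2))
      atTop (𝓝 ((pressureTT'₂ β t t' U x y' - Real.binEntropy y') - (pressureTT'₂ β t t' U x y - Real.binEntropy y))) :=
    ((tendsto_spinSectorPressureTT' hβ t t' hU hx0 hx1 hy'0 hy'1).sub (tendsto_log_choose_halfRectN_div_sq hy'0 hy'1)).sub
      ((tendsto_spinSectorPressureTT' hβ t t' hU hx0 hx1 hy0 hy1).sub (tendsto_log_choose_halfRectN_div_sq hy0 hy1))
  have hk : Tendsto (fun L : ℕ => ((halfRectN (2 * y') L : ℝ) - halfRectN (2 * y) L) / (L : ℝ) ^ 2) atTop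
      (𝓝 (y' - y)) := by
    have h := (tendsto_halfRectN_div_sq''' (n := 2 * y') (by linarith)).sub
      (tendsto_halfRectN_div_sq''' (n := 2 * y) (by linarith))
    rw [show y' - y = 2 * y' / 2 - 2 * y / 2 by ring]
    refine h.congr fun L => ?_
    rw [sub_div]
  constructor
  · have hG := (hk.const_mul (β * (4 * |t| + 4 * |t'| + U))).neg
    exact le_of_tendsto_of_tendsto hG hF (eventually_atTop.2 ⟨1, fun L hL => (hfin L hL).1⟩)
  · have hG := hk.const_mul (β * (4 * |t| + 4 * |t'|))
    exact le_of_tendsto_of_tendsto hF hG (eventually_atTop.2 ⟨1, fun L hL => (hfin L hL).2⟩)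

end DensityLegs

end ThermodynamicLimit

end Literature.MathematicalPhysics.QuantumLattice
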